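import Mathlib

/-!
# Gram–Cauchy–Schwarz inequality for determinants (helper for `BackgroundSchwarz`)

For complex matrices `X Y : Matrix m n ℂ`:

* `det (Xᴴ X)` is real and non-negative;
* `‖det (Xᴴ Y)‖² ≤ det (Xᴴ X) · det (Yᴴ Y)` (Cauchy–Schwarz for the Gram pairing of
  `n`-frames, i.e. for the inner product `det (Xᴴ Y)` of the decomposable `n`-vectors
  `x₁ ∧ ⋯ ∧ xₙ`, `y₁ ∧ ⋯ ∧ yₙ`).

The proof avoids Cauchy–Binet: with `G = Xᴴ X` invertible and `P = X G⁻¹ Xᴴ` the orthogonal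
projection onto the column space of `X`, `Yᴴ Y = Yᴴ P Y + (QY)ᴴ (QY)` with `Q = 1 - P`, and
`det (Yᴴ P Y) = ‖det (Xᴴ Y)‖² / det G`; monotonicity of `det` on the positive semidefinite cone
(`det B ≤ det (B + C)`) finishes.  These are the linear-algebra lemmas behind the background
Schwarz inequality of route WilsonQuarkChessboard (item `BackgroundSchwarz`).
-/

namespace Summit.QuantumFields.QCD.Theorems.BackgroundSchwarz

open Matrix
open scoped ComplexOrder MatrixOrder ComplexConjugate

variable {m n : Type*} [Fintype m] [Fintype n] [DecidableEq n]

/-- For a positive semidefinite complex matrix `P`, `det (1 + P)` is real and at least `1`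
(each eigenvalue of `1 + P` is `1 + ⟨v, P v⟩ ≥ 1` for a unit eigenvector `v`). -/
theorem one_le_det_one_add {P : Matrix n n ℂ} (hP : P.PosSemidef) :
    (1 : ℂ) ≤ (1 + P).det := by
  have hH : (1 + P).IsHermitian := (PosSemidef.one.add hP).isHermitian
  rw [hH.det_eq_prod_eigenvalues]
  have h1 : ∀ i, (1 : ℝ) ≤ hH.eigenvalues i := by
    intro i
    rw [hH.eigenvalues_eq i, add_mulVec, one_mulVec, dotProduct_add, map_add]
    have hv : ‖hH.eigenvectorBasis i‖ = 1 := hH.eigenvectorBasis.orthonormal.1 i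
    have hre : RCLike.re (star ⇑(hH.eigenvectorBasis i) ⬝ᵥ ⇑(hH.eigenvectorBasis i)) = (1 : ℝ) := by
      rw [dotProduct_comm, ← EuclideanSpace.inner_eq_star_dotProduct, inner_self_eq_norm_sq_to_K,
        hv]
      simp
    rw [hre]
    have := hP.re_dotProduct_nonneg (⇑(hH.eigenvectorBasis i))
    linarith
  have hprod : (1 : ℝ) ≤ ∏ i, hH.eigenvalues i := by
    calc (1 : ℝ) = ∏ _i : n, (1 : ℝ) := by simp
      _ ≤ ∏ i, hH.eigenvalues i :=
        Finset.prod_le_prod (fun _ _ => zero_le_one) fun i _ => h1 i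
  have hcoe : ∀ x : ℝ, (RCLike.ofReal x : ℂ) = (x : ℂ) := fun x => rfl
  simp only [hcoe]
  exact_mod_cast hprod

/-- **Monotonicity of `det` on the positive semidefinite cone** (complex matrices):
`det B ≤ det (B + C)` for `B, C ⪰ 0` (both determinants are real and non-negative). -/
theorem det_le_det_add {B C : Matrix n n ℂ} (hB : B.PosSemidef) (hC : C.PosSemidef) :
    B.det ≤ (B + C).det := by
  by_cases hdet : B.det = 0
  · rw [hdet]; exact (hB.add hC).det_nonneg
  have hBd : B.PosDef := hB.posDef_iff_det_ne_zero.2 hdet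
  have hBu : IsUnit B.det := isUnit_iff_ne_zero.2 hdet
  -- factor `C = Eᴴ E`
  obtain ⟨E, hE⟩ := CStarAlgebra.nonneg_iff_eq_star_mul_self.mp hC.nonneg
  have hfac : B + C = B * (1 + B⁻¹ * C) := by
    rw [Matrix.mul_add, Matrix.mul_one, ← Matrix.mul_assoc, mul_nonsing_inv _ hBu, Matrix.one_mul]
  have hcomm : (1 + B⁻¹ * C).det = (1 + E * B⁻¹ * Eᴴ).det := by
    rw [hE, star_eq_conjTranspose, ← Matrix.mul_assoc, det_one_add_mul_comm, ← Matrix.mul_assoc]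
  have hPSD : (E * B⁻¹ * Eᴴ).PosSemidef := hB.inv.mul_mul_conjTranspose_same E
  have h1 : (1 : ℂ) ≤ (1 + B⁻¹ * C).det := hcomm ▸ one_le_det_one_add hPSD
  rw [hfac, det_mul]
  have hBpos : (0 : ℂ) < B.det := hBd.det_pos
  calc B.det = B.det * 1 := (mul_one _).symm
    _ ≤ B.det * (1 + B⁻¹ * C).det := mul_le_mul_of_nonneg_left h1 hBpos.le

/-- The Gram determinant `det (Xᴴ X)` is real and non-negative. -/
theorem gram_det_nonneg (X : Matrix m n ℂ) : (0 : ℂ) ≤ (Xᴴ * X).det :=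
  (posSemidef_conjTranspose_mul_self X).det_nonneg

/-- **Gram–Cauchy–Schwarz for determinants**: `‖det (Xᴴ Y)‖² ≤ det (Xᴴ X) · det (Yᴴ Y)`
(as an inequality in `ℂ` with its real partial order; both Gram determinants are real `≥ 0`). -/
theorem normSq_det_conjTranspose_mul_le (X Y : Matrix m n ℂ) :
    ((‖(Xᴴ * Y).det‖ ^ 2 : ℝ) : ℂ) ≤ (Xᴴ * X).det * (Yᴴ * Y).det := by
  classical
  set G := Xᴴ * X with hG
  set K := Xᴴ * Y with hK
  have hGpsd : G.PosSemidef := posSemidef_conjTranspose_mul_self X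
  by_cases hdet : G.det = 0
  · -- `X` has a kernel vector, hence so does `Yᴴ X`, and `det (Xᴴ Y) = 0`
    obtain ⟨v, hv0, hv⟩ := Matrix.exists_mulVec_eq_zero_iff.2 hdet
    have hXv : X *ᵥ v = 0 := by
      have h1 : star v ⬝ᵥ (G *ᵥ v) = 0 := by rw [hv, dotProduct_zero]
      rw [hG, ← mulVec_mulVec, dotProduct_mulVec, ← star_mulVec] at h1
      exact dotProduct_star_self_eq_zero.1 h1
    have hK0 : K.det = 0 := by
      have h2 : (Yᴴ * X).det = 0 :=
        Matrix.exists_mulVec_eq_zero_iff.1 ⟨v, hv0, by rw [← mulVec_mulVec, hXv, mulVec_zero]⟩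
      have h3 : K = (Yᴴ * X)ᴴ := by rw [hK, conjTranspose_mul, conjTranspose_conjTranspose]
      rw [h3, det_conjTranspose, h2, star_zero]
    rw [hK0, hdet, norm_zero, zero_mul]
    simp
  · have hGd : G.PosDef := hGpsd.posDef_iff_det_ne_zero.2 hdet
    have hGu : IsUnit G.det := isUnit_iff_ne_zero.2 hdet
    have hGH : Gᴴ = G := hGpsd.isHermitian
    -- the projection `Q = 1 - X G⁻¹ Xᴴ` onto the orthogonal complement of the column space
    set Q : Matrix m m ℂ := 1 - X * G⁻¹ * Xᴴ with hQ
    have hGinvH : (G⁻¹)ᴴ = G⁻¹ := by rw [conjTranspose_nonsing_inv, hGH]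
    have hQH : Qᴴ = Q := by
      rw [hQ, conjTranspose_sub, conjTranspose_one, conjTranspose_mul, conjTranspose_mul,
        conjTranspose_conjTranspose, hGinvH, Matrix.mul_assoc]
    have hXGX : Xᴴ * (X * G⁻¹) = 1 := by
      rw [← Matrix.mul_assoc, ← hG, mul_nonsing_inv _ hGu]
    have hQQ : Q * Q = Q := by
      have : X * G⁻¹ * Xᴴ * (X * G⁻¹ * Xᴴ) = X * G⁻¹ * Xᴴ := by
        rw [Matrix.mul_assoc (X * G⁻¹) Xᴴ, ← Matrix.mul_assoc Xᴴ, ← Matrix.mul_assoc Xᴴ,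
          show Xᴴ * X * G⁻¹ = 1 by rw [← hG, mul_nonsing_inv _ hGu], Matrix.one_mul]
      rw [hQ, Matrix.sub_mul, Matrix.mul_sub, Matrix.mul_sub, Matrix.one_mul, Matrix.one_mul,
        Matrix.mul_one, this, sub_self, sub_zero]
    set B : Matrix n n ℂ := Kᴴ * G⁻¹ * K with hB
    set C : Matrix n n ℂ := (Q * Y)ᴴ * (Q * Y) with hC
    have hBpsd : B.PosSemidef := hGpsd.inv.conjTranspose_mul_mul_same K
    have hCpsd : C.PosSemidef := posSemidef_conjTranspose_mul_self (Q * Y)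
    have hsum : Yᴴ * Y = B + C := by
      have hC' : C = Yᴴ * Y - B := by
        rw [hC, conjTranspose_mul, hQH, Matrix.mul_assoc, ← Matrix.mul_assoc Q, hQQ, hQ,
          Matrix.sub_mul, Matrix.mul_sub, Matrix.one_mul, hB, hK, conjTranspose_mul,
          conjTranspose_conjTranspose]
        simp only [Matrix.mul_assoc]
      rw [hC', add_sub_cancel]
    have hmono : B.det ≤ (Yᴴ * Y).det := hsum ▸ det_le_det_add hBpsd hCpsd
    have hBdet : G.det * B.det = ((‖K.det‖ ^ 2 : ℝ) : ℂ) := by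
      rw [hB, det_mul, det_mul, det_conjTranspose, det_nonsing_inv, Ring.inverse_eq_inv',
        Complex.ofReal_pow, ← Complex.conj_mul']
      field_simp
      rw [Complex.star_def, mul_comm]
    have hGpos : (0 : ℂ) < G.det := hGd.det_pos
    calc ((‖K.det‖ ^ 2 : ℝ) : ℂ) = G.det * B.det := hBdet.symm
      _ ≤ G.det * (Yᴴ * Y).det := mul_le_mul_of_nonneg_left hmono hGpos.le

/-- Real-part form of the Gram–Cauchy–Schwarz inequality. -/
theorem normSq_det_conjTranspose_mul_le_re (X Y : Matrix m n ℂ) :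
    ‖(Xᴴ * Y).det‖ ^ 2 ≤ ((Xᴴ * X).det).re * ((Yᴴ * Y).det).re := by
  have h := normSq_det_conjTranspose_mul_le X Y
  have hX := gram_det_nonneg X
  have hY := gram_det_nonneg Y
  rw [Complex.le_def] at h hX hY
  simp only [Complex.ofReal_re, Complex.mul_re, Complex.zero_im] at h hX hY
  rw [← hX.2, ← hY.2, mul_zero, sub_zero] at h
  exact h.1

end Summit.QuantumFields.QCD.Theorems.BackgroundSchwarz
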